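import Summits.QuantumFields.YangMills.Theorems.BalabanUVNodesN12ForestSliceOfProxies
import Summits.QuantumFields.YangMills.Theorems.BalabanUVNodesN12ForestSliceLeftField
import HarnessLib

/-!
# BalabanUVNodes ∕ N12 — THE (J0′) PRODUCER OF RECORD AT `𝐁_k(Z)` WITH dag-n12-w3's PLAQUETTE-GUARD ROW `t₀` AND THE SURJECTIVITY ROW `hsurj` BOTH GONE
# ([Balaban1985Variational] Thm 1 p. 279, (4) p. 278, (16)–(18) p. 280, Sect. C (44)–(48) p. 285, (82)–(83) p. 290; [Balaban1985Averaging] (11) p. 19; [Balaban1988Convergent] (2.2) p. 255,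
# (2.10)–(2.13) pp. 256–257; [Balaban1989LargeFieldI] (1.74) p. 192, Prop. 1 p. 194)

Cell `pub-ymgap` (HUMAN RULINGS D-0062 ∕ D-0149), WIDTH SEAT `pub-ymgap-dag-n12-w6` g11 (node N12 = [B15]; key K1⁹ `stmt-QuantumFields-27364`, `--kind proof --supports … --as helper`;
count-neutral).  THEOREMS ONLY (0 `def`, 0 `instance`, 0 `sorry`); by name over this lineage's g11 `N12ForestSliceOfProxies` ∕ `N12HsurjOfClass` (p705019), dag-n12-w3's `N12ForestSliceLeftField` ∕
`N12ForestSlice`, dag-n10-w1's `N12GuardedLinAvgRightInverseLeft.dIterL_leftField_eq_of_suProj_qLin_eq`, dag-n12-w1's `B15Prop1RightInverseFromForestLeftField.hR_of_forest_leftField`,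
`B15Prop1MinimiserFamilyFromThm1AtBaseCentral.hMin_atRecord_of_node00Letters_thm1AtBase_central`, `N12ClassLetterGeometryOfRecord.classLetters_closure_regMSCoPOfRecord_Bj`, NODE 00's
`fderiv_msChart_apply_of_hasDerivAt` ∕ `hasDerivAt_coeField_iter_expChart_smul` ∕ `coeField_avgFamily_eq_iterM`.

WHY (LOCATED-HSURJ rows (i)+(ii), this seat, bus 2026-08-29 06:49Z).  dag-n12-w1 g4's (J0′) producer `N12MinimiserFamilyAtRecordBj.hMin_atRecord_Bj_of_printLetters` displays per base field,
besides the two (0.4) guards `hsbQ`∕`hsbU` (plan g91 LOCATED-E1-HSB, repair (r1)–(r3)), two more rows with no large-field producer: (i) `hsurj` (removed by `N12HsurjOfClass`, from the class)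
and (ii) dag-n12-w3's plaquette guards `∃ t₀, 0 < t₀ ∧ stokesConst·t₀ < δ_2 ∧ ∀ i < k, PlaqSmall t₀ (Ū^i U₀)` — every plaquette of every iterated average of `U₀`.  Row (ii) is IDLE given
the displayed `hsbU : SmallBelow k U₀`: it was used only through `smallBelow_of_plaqSmall` and dag-n10-w1's `t₀`-phrased junction `fderiv_msChart_apply_eq_suProj_qLin`, whose `SmallBelow`
edition is NODE 00's velocity formula (§1).  THIS FILE re-threads dag-n12-w3's left-field letter and dag-n12-w1 g3∕g4's two knit links on `SmallBelow k U₀` alone and feeds `hsurj` from the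
class: per base field the producer now displays EXACTLY (E) the minimiser, `hsbQ`, `hsbU`, (β), (T1@q₀) — the (r3) targets and N07∕K0 letters, nothing else.

CONTENTS.  §1 ★ `fderiv_msChart_apply_eq_suProj_qLin_of_smallBelow` (dag-n10-w1's junction, `SmallBelow` only).  §2 ★★ `exists_forest_leftField_of_smallBelow_of_agreeOn` (dag-n12-w3's
`exists_forest_leftField_of_surjective_curved_of_agreeOn`, `t₀` ↦ `SmallBelow k U₀`; via `N12ForestSliceOfProxies.exists_forest_preimage_of_surjective_proxies` with `U₀` its own proxy).
§3 ★★ `hR_forest_of_surjective_smallBelow` (dag-n12-w1 g3's `hR_forest_of_surjective_curved`, `t₀` ↦ `SmallBelow`).  §4 ★★★ `hMin_atRecord_of_node00Letters_thm1AtBase_central_surj_smallBelow`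
(dag-n12-w1 g3's `…_central_surj` with the `t₀` conjunct of `hbase` DROPPED).  §5 ★★★ `hMin_atRecord_Bj_of_printLetters_ofClass` (dag-n12-w1 g4's producer at `kc := k` with BOTH the `t₀`
and the `hsurj` conjuncts DROPPED; rows added once per instance: `N12HsurjOfClass`'s per-height letters `hsbU′`∕`hHB` + floors, `k + 1 ≤ m + K`).

HONEST FRAMING.  Bookkeeping by name; `hsbQ`∕`hsbU` REMAIN displayed ((0.4)-regime rows until (r3)); per-height EXISTENCE letters; nothing of Bałaban's estimates asserted or refuted; N12 NOT
discharged; K1⁹ NOT closed; counts of record unmoved; one finite 𝕋⁴ programme at fixed ε — R4 closes only the conditional rung `BalabanLadder.UV`; no summit statement is proved here and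
NOT the Yang–Mills mass gap (Clay); nothing continuum ∕ ℝ⁴ ∕ OS.
-/

noncomputable section

namespace Summit.QuantumFields.YangMills.BalabanUVNodes.N12MinimiserFamilyAtRecordBjNoPlaqGuard

open scoped BigOperators Matrix.Norms.L2Operator Topology
open Filter
open Literature.MathematicalPhysics.QuantumFieldTheory.Balaban1983to89
open T4Continuum
open B15DeterminingSets GaugeField
open BlockAveraging (blockAvg)
open ExpMeanLog (expMeanLogSU deltaSU)
open T4AdjointCovarianceUnitary (lieSU expSU specialUnitaryAd coe_specialUnitaryAd)
open Node00
open B15SU2ChartHolomorphic (genE)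
open B15Prop1AnalyticExtClause (cplxVec)
open B15Prop1ChartCalculusSU2 (E3)
open T4CubeChartGnomonic (SU2)
open B14.Eq213DetSet (Bj maxDomT Bj_of_gt)
open B14.Eq213MaximalDomains (side)
open B14.Eq216Concrete (feeds)
open B5Eq118OneStroke (iterBlockOf)
open B15Eq112TorusCover (lift)
open T4AxialGaugeSmallField (boxPlaqs)
open T4ReflectionCone (three_le_L)
open Summit.QuantumFields.YangMills.Theorems.BlockAvgCorrector (stokesConst)
open Summit.QuantumFields.YangMills.BalabanUVNodes.N12ForestSliceOfProxies (exists_forest_preimage_of_surjective_proxies)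
open Summit.QuantumFields.YangMills.BalabanUVNodes.N12HsurjOfClass (surjective_fderiv_msChart_Bj_of_isMinimizer_class)
open Summit.QuantumFields.YangMills.BalabanUVNodes.N12GuardedLinAvgRightInverseLeft (dIterL_leftField_eq_of_suProj_qLin_eq)
open Summit.QuantumFields.YangMills.BalabanUVNodes.N12ClassLetterGeometryOfRecord (classLetters_closure_regMSCoPOfRecord_Bj)
open Summit.QuantumFields.YangMills.BalabanUVNodes.N12ForestSlice (exists_forest_slice_Bj)
open Literature.MathematicalPhysics.QuantumFieldTheory.Balaban1983to89.B15Prop1RightInverseFromForestLeftField (hR_of_forest_leftField)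
open Literature.MathematicalPhysics.QuantumFieldTheory.Balaban1983to89.B15Prop1MinimiserFamilyFromThm1AtBaseCentral (hMin_atRecord_of_node00Letters_thm1AtBase_central)
open Literature.MathematicalPhysics.QuantumFieldTheory.BalabanImbrieJaffe1984to88.BIJ85Eq453GaugeField (qsstarGIter0)
open B15AveragingHolomorphic (iterMh)
open B15SU2ChartHolomorphic (expMulC logCoordC)
open B15ShellGauge193 (shellGauge)
open B15Extension193 (extend)
open B16Sect1Backgrounds (toMS expMul)
open B15Prop1ChartSU2 (su2Chart)
open Metric (ball)

/-! ## §1  dag-n10-w1's chart∕`qLin` junction from `SmallBelow` alone -/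

section Junction

variable {F : T4Family} {N : ℕ} [NeZero N] {K k : ℕ}

/-- ★ **`(DΦ_U(0)X)_i = π(qLin j U X c)` FROM THE (0.4) GUARDS ALONE** — dag-n10-w1's `N12GuardedChartDerivQLinJunction.fderiv_msChart_apply_eq_suProj_qLin` with the plaquette guard
«`∀ i < k, PlaqSmall t₀ (Ū^i U)`, `stokesConst·t₀ < δ_N`» REPLACED by `SmallBelow … k U`: NODE 00's velocity formula `fderiv_msChart_apply_of_hasDerivAt` fed by
`hasDerivAt_coeField_iter_expChart_smul` and `coeField_avgFamily_eq_iterM`. [cite: Balaban1985Variational, (44)–(48) p.285, (83) p.290; Balaban1987RG1, (0.4) p.253, (0.21) p.256] -/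
theorem fderiv_msChart_apply_eq_suProj_qLin_of_smallBelow {U : GaugeField (F.P K) 0 (SU N)} (hsb : SmallBelow (avOfRecord F N K) k U)
    (𝔹 : DetSet (F.P K)) (X : PBond (F.P K) 0 → lieSU (Fin N)) (i : Fin (constrCard 𝔹 k)) :
    fderiv ℝ (msChart F N K k 𝔹 (avgFamily (avOfRecord F N K) U) U) 0 X i
      = suProj N (qLin (((constrEnum 𝔹 k).symm i).1 : ℕ) U X ((constrEnum 𝔹 k).symm i).2.1) := by
  set s := (constrEnum 𝔹 k).symm i with hs
  have hj : (s.1 : ℕ) ≤ k := Nat.lt_succ_iff.1 s.1.2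
  have hsbj : SmallBelow (fun i => blockAvg (P := F.P K) (j := i) (expMeanLogSU (n := Fin N))) (s.1 : ℕ) U := hsb.mono hj
  have hvelc : HasDerivAt (fun t : ℝ => ((avgFamily (avOfRecord F N K) (expChart U (t • X)) s.1 s.2.1 : SU N) : Matrix (Fin N) (Fin N) ℂ))
      (dIterL (s.1 : ℕ) (coeField U) (fun b => (U b : Matrix (Fin N) (Fin N) ℂ) * (X b : Matrix (Fin N) (Fin N) ℂ)) s.2.1) 0 :=
    (hasDerivAt_pi.1 (hasDerivAt_coeField_iter_expChart_smul hsbj X)) s.2.1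
  have hWeq : ((avgFamily (avOfRecord F N K) U s.1 s.2.1 : SU N) : Matrix (Fin N) (Fin N) ℂ)
      = (iterM (s.1 : ℕ) : (PBond (F.P K) 0 → Matrix (Fin N) (Fin N) ℂ) → PBond (F.P K) s.1 → Matrix (Fin N) (Fin N) ℂ) (coeField U) s.2.1 := by
    have h := congrFun (coeField_avgFamily_eq_iterM (k := (s.1 : ℕ)) hsbj) s.2.1
    rw [coeField_apply] at h
    exact h
  rw [fderiv_msChart_apply_of_hasDerivAt (fun _ _ _ => rfl) hsb X i hvelc, qLin_apply, ← hWeq]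

end Junction

/-! ## §2  dag-n12-w3's forest left-field letter from `SmallBelow k U₀` (no plaquette guard) -/

section LeftField

variable {F : T4Family} {N : ℕ} [NeZero N] {K k : ℕ}

/-- ★★ **THE FOREST LEFT-FIELD LETTER AT A BASE WITH THE (0.4) GUARDS ONLY** — dag-n12-w3's `N12ForestSliceLeftField.exists_forest_leftField_of_surjective_curved_of_agreeOn` with the
plaquette guards `t₀` REPLACED by `SmallBelow … k U₀` (`U₀` is then its own proxy on every sharp tower: `N12ForestSliceOfProxies.exists_forest_preimage_of_surjective_proxies`; the read-back
to `Q_j = dIterL` is dag-n10-w1's `dIterL_leftField_eq_of_suProj_qLin_eq` over §1).  Datum `W` of the fibre through `U₀` on the right-hand side; surjectivity of `DΦ_{U₀}(0)` displayed.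
[cite: Balaban1985Variational, (3)–(4) p.278, (16)–(18) p.280, (44)–(45) p.285; Balaban1985Averaging, (11) p.19; Balaban1985RegularSpaces, (1.19) p.79; Balaban1988Convergent, (2.10)–(2.12) p.256] -/
theorem exists_forest_leftField_of_smallBelow_of_agreeOn (𝔹 : DetSet (F.P K)) (hk : k ≤ (F.P K).m + (F.P K).K)
    {U₀ : GaugeField (F.P K) 0 (SU N)} (hsb : SmallBelow (avOfRecord F N K) k U₀)
    {W : MSField (F.P K) (SU N)} (hW : AgreeOn 𝔹 (avgFamily (avOfRecord F N K) U₀) W)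
    {path : Site (F.P K) 0 → List (LStep (F.P K) 0)}
    (hroot : ∀ r ∈ {z : Site (F.P K) 0 | ∃ j, j ≤ k ∧ ∃ c ∈ bondsOf (𝔹 j), (z = embIter j c.src ∨ z = embIter j c.tgt)}, path r = [])
    (hF1 : ∀ x, ∀ s ∈ path x, ∃ x' x'' : Site (F.P K) 0, path x'' = path x' ++ [s] ∧
      (s.fwd = true → s.bond.src = x' ∧ s.bond.tgt = x'') ∧ (s.fwd = false → s.bond.src = x'' ∧ s.bond.tgt = x'))
    (hsurj : Function.Surjective (fderiv ℝ (msChart F N K k 𝔹 (avgFamily (avOfRecord F N K) U₀) U₀) 0))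
    (y : Fin (constrCard 𝔹 k) → lieSU (Fin N)) :
    ∃ p : PBond (F.P K) 0 → lieSU (Fin N), (∀ x, ∀ s ∈ path x, p s.bond = 0) ∧
      ∀ i : Fin (constrCard 𝔹 k), dIterL (((constrEnum 𝔹 k).symm i).1 : ℕ) (coeField U₀)
          (fun b => (p b : Matrix (Fin N) (Fin N) ℂ) * (U₀ b : Matrix (Fin N) (Fin N) ℂ)) ((constrEnum 𝔹 k).symm i).2.1 =
        ((W ((constrEnum 𝔹 k).symm i).1 ((constrEnum 𝔹 k).symm i).2.1 : SU N) : Matrix (Fin N) (Fin N) ℂ) * (y i : Matrix (Fin N) (Fin N) ℂ) := by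
  have hΨ : DifferentiableAt ℝ (msChart F N K k 𝔹 (avgFamily (avOfRecord F N K) U₀) U₀) 0 :=
    differentiableAt_msChart (K := K) (k := k) (𝔹 := 𝔹) (W := avgFamily (avOfRecord F N K) U₀) (U := U₀) (fun _ _ _ => rfl) hsb
  obtain ⟨X, hXS, hX⟩ := exists_forest_preimage_of_surjective_proxies 𝔹 hk (W := avgFamily (avOfRecord F N K) U₀) (fun _ _ _ => rfl) hΨ
    (fun i _ => ⟨U₀, hsb, fun _ _ _ => rfl⟩) hroot hF1 hsurj y
  refine ⟨fun b => specialUnitaryAd (U₀ b) (X b), fun x s hs => by beta_reduce; rw [hXS x s hs, map_zero], fun i => ?_⟩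
  have hj : (((constrEnum 𝔹 k).symm i).1 : ℕ) ≤ k := Nat.le_of_lt_succ ((constrEnum 𝔹 k).symm i).1.isLt
  have hq : suProj N (qLin (((constrEnum 𝔹 k).symm i).1 : ℕ) U₀ X ((constrEnum 𝔹 k).symm i).2.1) = y i := by
    rw [← fderiv_msChart_apply_eq_suProj_qLin_of_smallBelow hsb 𝔹 X i, hX]
  rw [dIterL_leftField_eq_of_suProj_qLin_eq (hsb.mono hj) X _ hq, ← hW _ _ ((constrEnum 𝔹 k).symm i).2.2]
  rfl

end LeftField

/-! ## §3  dag-n12-w1's (45) letter `hR` for the forest slice from `SmallBelow k U₀` -/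

section HR

variable {F : T4Family} {K k : ℕ}

/-- ★★ **THE (45) LETTER `hR` FOR THE FOREST SLICE AT A BASE WITH THE (0.4) GUARDS ONLY** — dag-n12-w1 g3's `N12RightInverseLetterOfForest.hR_forest_of_surjective_curved` (left-field
`ℝ³`-coordinate currency, slice `S` = the axial slice (F3) of a rooted forest with (F1) and roots ⊇ the block-tower sites of the constrained bonds) with dag-n12-w3's plaquette guards `t₀`
REPLACED by `SmallBelow … k U₀`; surjectivity of `DΦ_{U₀}(0)` displayed.
[cite: Balaban1985Variational, Sect. C (44)–(48) p.285, (82)–(83) p.290; Balaban1985RegularSpaces, (1.19) p.79; Balaban1989LargeFieldII, (1.19) p.360] -/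
theorem hR_forest_of_surjective_smallBelow (𝔹 : DetSet (F.P K)) (hk : k ≤ (F.P K).m + (F.P K).K)
    {U₀ : GaugeField (F.P K) 0 SU2} (hsb : SmallBelow (avOfRecord F 2 K) k U₀)
    {W : MSField (F.P K) SU2} (hW : AgreeOn 𝔹 (avgFamily (avOfRecord F 2 K) U₀) W)
    (S : Submodule ℂ (VecField (F.P K) 0 (EuclideanSpace ℂ (Fin 3))))
    {path : Site (F.P K) 0 → List (LStep (F.P K) 0)}
    (hroot : ∀ r ∈ {z : Site (F.P K) 0 | ∃ j, j ≤ k ∧ ∃ c ∈ bondsOf (𝔹 j), (z = embIter j c.src ∨ z = embIter j c.tgt)}, path r = [])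
    (hF1 : ∀ x, ∀ s ∈ path x, ∃ x' x'' : Site (F.P K) 0, path x'' = path x' ++ [s] ∧
      (s.fwd = true → s.bond.src = x' ∧ s.bond.tgt = x'') ∧ (s.fwd = false → s.bond.src = x'' ∧ s.bond.tgt = x'))
    (hF3 : ∀ X : VecField (F.P K) 0 (EuclideanSpace ℂ (Fin 3)), X ∈ S ↔ ∀ x, ∀ s ∈ path x, X s.bond = 0)
    (hsurj : Function.Surjective (fderiv ℝ (msChart F 2 K k 𝔹 (avgFamily (avOfRecord F 2 K) U₀) U₀) 0)) :
    ∀ τ : Fin (constrCard 𝔹 k) → EuclideanSpace ℝ (Fin 3), ∃ p : VecField (F.P K) 0 E3, cplxVec p ∈ S ∧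
      ∀ i : Fin (constrCard 𝔹 k), dIterL ((constrEnum 𝔹 k).symm i).1 (coeField U₀)
        (fun b => (∑ a : Fin 3, ((p b a : ℝ) : ℂ) • genE a) * ((U₀ b : SU2) : Matrix (Fin 2) (Fin 2) ℂ)) ((constrEnum 𝔹 k).symm i).2.1 =
        ((W ((constrEnum 𝔹 k).symm i).1 ((constrEnum 𝔹 k).symm i).2.1 : SU2) : Matrix (Fin 2) (Fin 2) ℂ) * ∑ b : Fin 3, ((τ i b : ℝ) : ℂ) • genE b :=
  hR_of_forest_leftField 𝔹 k W U₀ S path hF3 fun y =>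
    exists_forest_leftField_of_smallBelow_of_agreeOn 𝔹 hk hsb hW hroot hF1 hsurj y

end HR

/-! ## §4  dag-n12-w1 g3's knit link WITHOUT the plaquette-guard row -/

section Central

variable {F : T4Family} {k : ℕ}

/-- ★★★ **THE LINEAGE's BEST THEOREM WITH (45) DISCHARGED BY THE FOREST RIGHT INVERSE — NO PLAQUETTE-GUARD ROW** — dag-n12-w1 g3's
`N12RightInverseLetterOfForest.hMin_atRecord_of_node00Letters_thm1AtBase_central_surj` with the conjunct «`∃ t₀ > 0, stokesConst·t₀ < δ_2 ∧ ∀ i < k, PlaqSmall t₀ (Ū^i U₀)`» of `hbase`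
REMOVED: (45) `hR` is supplied by §3 from the displayed `hsbU : SmallBelow k U₀` and the displayed surjectivity of `DΦ_{U₀}(0)`.  Per base field the displayed letters are: minimiser `U₀` + the
two (0.4) guards, forest (F1)(F2)(F3) with `a`, `Φ₀`, `DΦ_{U₀}(0)` onto, (β) `hposN`, (T1@q₀); plus the class facts and `k ≤ m + K`.
[cite: Balaban1985Variational, Thm 1 p.279, (3)–(4) p.278, (16)–(18) p.280, Sect. C (44)–(48) p.285, (82)–(83) p.290, Prop. 8 p.305, Prop. 9 (190) p.309; Balaban1985RegularSpaces, (1.19) p.79; Balaban1989LargeFieldI, (1.74) p.192, Prop. 1 p.194; Balaban1989LargeFieldII, (1.9) p.358, (1.12) p.359; Balaban1988Convergent, (2.10)–(2.12) p.256] -/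
theorem hMin_atRecord_of_node00Letters_thm1AtBase_central_surj_smallBelow (ν : Node00.Stage7Numerics) (Kt kc : ℕ) (Ω : ℕ → Set (Site (F.P Kt) 0))
    (Λ : Set (Site (F.P Kt) k)) (lo hi : Fin (F.P Kt).d → ℤ) (𝔹 : DetSet (F.P Kt)) (h𝔹 : ∀ j, k < j → 𝔹 j = ∅) (hk : k ≤ (F.P Kt).m + (F.P Kt).K)
    (ext : GaugeField (F.P Kt) k SU2 → GaugeField (F.P Kt) k SU2) (hext : ∀ W, ext W = extend Λ (shellGauge W lo hi) W)
    {K : Set (GaugeField (F.P Kt) k SU2)} (hK : IsCompact K) {𝓐₀ : ℝ} (h𝓐₀ : 1 < 𝓐₀)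
    (reg' : Set (GaugeField (F.P Kt) 0 SU2)) (hreg' : IsClosed reg') (hcl : closure (Node00.regMSCoPOfRecord F 2 ν Kt kc Ω) ⊆ reg')
    (hDreg' : ContinuousOn (fun (U : GaugeField (F.P Kt) 0 SU2) (i : Fin (constrCard 𝔹 k)) =>
      ((avgFamily (Node00.avOfRecord F 2 Kt) U ((constrEnum 𝔹 k).symm i).1 ((constrEnum 𝔹 k).symm i).2.1 : SU2) : Matrix (Fin 2) (Fin 2) ℂ)) reg')
    (hbase : ∀ Vk ∈ K, ∃ (U₀ : GaugeField (F.P Kt) 0 SU2) (S : Submodule ℂ (VecField (F.P Kt) 0 (EuclideanSpace ℂ (Fin 3)))) (path : Site (F.P Kt) 0 → List (LStep (F.P Kt) 0))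
        (a : S → ℂ) (Φ₀ : S → Fin (constrCard 𝔹 k) → EuclideanSpace ℂ (Fin 3)),
      IsMinimizer (Node00.avOfRecord F 2 Kt) (Node00.regMSCoPOfRecord F 2 ν Kt kc Ω) 𝔹
        (avgFamily (Node00.avOfRecord F 2 Kt) (qsstarGIter0 k (ext Vk))) U₀ ∧
      SmallBelow (Node00.avOfRecord F 2 Kt) k (qsstarGIter0 k (ext Vk)) ∧
      SmallBelow (Node00.avOfRecord F 2 Kt) k U₀ ∧
      (∀ x, ∀ s ∈ path x, ∃ x' x'' : Site (F.P Kt) 0, path x'' = path x' ++ [s] ∧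
        (s.fwd = true → s.bond.src = x' ∧ s.bond.tgt = x'') ∧ (s.fwd = false → s.bond.src = x'' ∧ s.bond.tgt = x')) ∧
      (∀ j, j ≤ k → ∀ c ∈ bondsOf (𝔹 j), path (embIter j c.src) = [] ∧ path (embIter j c.tgt) = []) ∧
      (∀ X : VecField (F.P Kt) 0 (EuclideanSpace ℂ (Fin 3)), X ∈ S ↔ ∀ x, ∀ s ∈ path x, X s.bond = 0) ∧
      (∀ X : S, a X = ∑ p : Plaq (F.P Kt) 0, (1 - (expMulC (X : VecField (F.P Kt) 0 (EuclideanSpace ℂ (Fin 3))) (coeField U₀) ⟨p.src, p.μ⟩ *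
        expMulC (X : VecField (F.P Kt) 0 (EuclideanSpace ℂ (Fin 3))) (coeField U₀) ⟨p.src.shift p.μ, p.ν⟩ *
        Matrix.adjugate (expMulC (X : VecField (F.P Kt) 0 (EuclideanSpace ℂ (Fin 3))) (coeField U₀) ⟨p.src.shift p.ν, p.μ⟩) *
        Matrix.adjugate (expMulC (X : VecField (F.P Kt) 0 (EuclideanSpace ℂ (Fin 3))) (coeField U₀) ⟨p.src, p.ν⟩)).trace / 2)) ∧
      (∀ (X : S) i, Φ₀ X i = logCoordC (star ((avgFamily (Node00.avOfRecord F 2 Kt) (qsstarGIter0 k (ext Vk))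
        ((constrEnum 𝔹 k).symm i).1 ((constrEnum 𝔹 k).symm i).2.1 : SU2) : Matrix (Fin 2) (Fin 2) ℂ) *
        iterMh ((constrEnum 𝔹 k).symm i).1 (expMulC (X : VecField (F.P Kt) 0 (EuclideanSpace ℂ (Fin 3))) (coeField U₀)) ((constrEnum 𝔹 k).symm i).2.1)) ∧
      -- the DISPLAYED surjectivity of `DΦ_{U₀}(0)` (NO plaquette-guard row any more)
      Function.Surjective (fderiv ℝ (Node00.msChart F 2 Kt k 𝔹 (avgFamily (Node00.avOfRecord F 2 Kt) U₀) U₀) 0) ∧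
      (∀ ℓ₀ : (Fin (constrCard 𝔹 k) → EuclideanSpace ℂ (Fin 3)) →L[ℂ] ℂ, fderiv ℂ a 0 = ℓ₀.comp (fderiv ℂ Φ₀ 0) →
        ∀ (p : VecField (F.P Kt) 0 E3) (hp : cplxVec p ∈ S), p ≠ 0 →
          (∀ i : Fin (constrCard 𝔹 k), dIterL ((constrEnum 𝔹 k).symm i).1 (coeField U₀)
            (fun b => (∑ a : Fin 3, ((p b a : ℝ) : ℂ) • genE a) * ((U₀ b : SU2) : Matrix (Fin 2) (Fin 2) ℂ)) ((constrEnum 𝔹 k).symm i).2.1 = 0) →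
          0 < deriv (deriv (fun t : ℝ => wilsonAction4 (expMul su2Chart (t • p) U₀) - (ℓ₀ (Φ₀ ((t : ℂ) • ⟨cplxVec p, hp⟩))).re)) 0) ∧
      (∀ U ∈ reg', AgreeOn 𝔹 (avgFamily (Node00.avOfRecord F 2 Kt) U) (avgFamily (Node00.avOfRecord F 2 Kt) (qsstarGIter0 k (ext Vk))) →
        wilsonAction4 U ≤ wilsonAction4 U₀ →
          ∃ u : GaugeTransf (F.P Kt) 0 SU2, (∀ j, j ≤ k → ∀ b ∈ bondsOf (𝔹 j), toMS u j b.src = toMS u j b.tgt ∧ ∀ g : SU2, toMS u j b.src * g = g * toMS u j b.src) ∧ gaugeAct u U = U₀)) :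
    ∃ R : ℝ, 0 < R ∧ ∀ Vk ∈ K,
      ∃ Ũ : VecField (F.P Kt) k (EuclideanSpace ℂ (Fin 3)) × VecField (F.P Kt) k (EuclideanSpace ℂ (Fin 3)) → PBond (F.P Kt) 0 → Matrix (Fin 2) (Fin 2) ℂ,
        (∀ b i j, DifferentiableOn ℂ (fun z => Ũ z b i j) (ball 0 R)) ∧
        (∀ z ∈ ball (0 : VecField (F.P Kt) k (EuclideanSpace ℂ (Fin 3)) × VecField (F.P Kt) k (EuclideanSpace ℂ (Fin 3))) R, ∀ b i j, ‖Ũ z b i j‖ ≤ 𝓐₀) ∧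
        ∀ p B' : VecField (F.P Kt) k E3, ‖p‖ < R → ‖B'‖ < R → ∃ U' : GaugeField (F.P Kt) 0 SU2,
          (∀ b, Ũ (cplxVec p, cplxVec B') b = ((U' b : SU2) : Matrix (Fin 2) (Fin 2) ℂ)) ∧
            IsMinimizer (Node00.avOfRecord F 2 Kt) (Node00.regMSCoPOfRecord F 2 ν Kt kc Ω) 𝔹
              (avgFamily (Node00.avOfRecord F 2 Kt) (qsstarGIter0 k (expMul su2Chart B' (ext (expMul su2Chart p Vk))))) U' :=
  hMin_atRecord_of_node00Letters_thm1AtBase_central ν Kt kc Ω Λ lo hi 𝔹 h𝔹 hk ext hext hK h𝓐₀ reg' hreg' hcl hDreg'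
    (fun Vk hVk => by
      obtain ⟨U₀, S, path, a, Φ₀, hmin, hsbQ, hsbU, hF1, hF2, hF3, ha, hΦ₀, hsurj, hposN, hT1⟩ := hbase Vk hVk
      have hroot : ∀ r ∈ {z : Site (F.P Kt) 0 | ∃ j, j ≤ k ∧ ∃ c ∈ bondsOf (𝔹 j), (z = embIter j c.src ∨ z = embIter j c.tgt)}, path r = [] := by
        rintro r ⟨j, hj, c, hc, hr | hr⟩
        · rw [hr]; exact (hF2 j hj c hc).1
        · rw [hr]; exact (hF2 j hj c hc).2
      exact ⟨U₀, S, path, a, Φ₀, hmin, hsbQ, hsbU, hF1, hF2, hF3, ha, hΦ₀,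
        hR_forest_of_surjective_smallBelow 𝔹 hk hsbU hmin.2.1 S hroot hF1 hF3 hsurj, hposN, hT1⟩)

end Central

/-! ## §5  dag-n12-w1 g4's (J0′) producer at `𝐁_k(Z)` with BOTH rows gone (the surjectivity from the class) -/

section Record

variable {F : T4Family} {k : ℕ}

/-- ★★★ **(J0′) `hMin` AT THE RECORD's `𝐁_k(Z)` FROM PRINT's PER-BASE-FIELD LETTERS — NO PLAQUETTE-GUARD ROW, NO SURJECTIVITY ROW.**  dag-n12-w1 g4's
`N12MinimiserFamilyAtRecordBj.hMin_atRecord_Bj_of_printLetters` at the knit's class index `kc := k` with the conjuncts «`∃ t₀, …PlaqSmall t₀ (Ū^i U₀)`» and «`DΦ_{U₀}(0)` onto» of `hbase`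
REMOVED (§4; `hsurj` per base field by `N12HsurjOfClass.surjective_fderiv_msChart_Bj_of_isMinimizer_class` from the class membership of the base minimiser).  Per base field the consumer now
supplies EXACTLY: the (2.12) minimiser `U₀` with the two (0.4) guards `hsbQ`∕`hsbU` (plan g91 LOCATED-E1-HSB; (r1)–(r3) in flight), (β) on every forest axial slice, (T1@q₀) over the closure of
the class.  Rows added once per instance: `N12HsurjOfClass`'s per-height letters `hsbU′` (ρ″), `hHB` (εH, B) with floors `6(d−1)L·εreg ≤ ρ″`, `εreg ≤ εH` (inhabited before `ν` by
`N12HsurjOfClass.exists_hsurjLetters`), and `k + 1 ≤ m + K`; numerics as dag-n12-w1 g4's.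
[cite: Balaban1985Variational, Thm 1 p.279, (1)–(2), (6)–(7) pp.277–279, (16)–(18) p.280, Sect. C (44)–(48) p.285, (82)–(83) p.290, Prop. 8 p.305, Prop. 9 (190) p.309; Balaban1985RegularSpaces, (1.19) p.79; Balaban1989LargeFieldI, (1.74) p.192, Prop. 1 p.194; Balaban1989LargeFieldII, (1.9) p.358, (1.12) p.359; Balaban1988Convergent, (2.2) p.255, (2.10)–(2.13) pp.256–257; Balaban1985Averaging, (11) p.19, Prop. 2 (52)–(54) p.26] -/
theorem hMin_atRecord_Bj_of_printLetters_ofClass (ν : Node00.Stage7Numerics) (Kt : ℕ) (Z : Set (Site (F.P Kt) 0))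
    (Λ : Set (Site (F.P Kt) k)) (lo hi : Fin (F.P Kt).d → ℤ) (hkK : k + 1 ≤ (F.P Kt).m + (F.P Kt).K) (hk1 : 1 ≤ k)
    (hdiv : side (F.P Kt).L ν.M₁ k ∣ (F.P Kt).sitesPerDir 0) (hfloor : ((F.P Kt).d + 14) * (F.P Kt).L ≤ ν.M₁) (hε : 0 < ν.εreg)
    (hα3 : (143 * (((((F.P Kt).d + 4 : ℕ) : ℝ)) ^ 2 / 4) ^ 2) * (2 * ((F.P Kt).L : ℝ) ^ 2 * ν.εreg) ≤ 1 / 3)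
    (hα2 : 2 * (2 * ((F.P Kt).L : ℝ) ^ 2 * ν.εreg) ≤ 2 * deltaSU (Fin 2) / ((((F.P Kt).d + 4) * (F.P Kt).L : ℕ) : ℝ) ^ 2)
    -- the per-HEIGHT letters of `N12HsurjOfClass` (inhabited before `ν`) and their floors
    {ρ'' : ℝ} (hsbU' : ∀ V : GaugeField (F.P Kt) 0 SU2, ‖coeField V - 1‖ ≤ ρ'' → SmallBelow (avOfRecord F 2 Kt) k V)
    (hερ : 6 * ((((F.P Kt).d - 1 : ℕ)) : ℝ) * (F.P Kt).L * ν.εreg ≤ ρ'')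
    {εH B : ℝ}
    (hHB : ∀ (Wd : MSField (F.P Kt) SU2) (U₀ : GaugeField (F.P Kt) 0 SU2),
      AgreeOn (Bj ν.M₁ Z k) (avgFamily (avOfRecord F 2 Kt) U₀) Wd →
      (∀ i' : Fin (constrCard (Bj ν.M₁ Z k) k), ∃ U' : GaugeField (F.P Kt) 0 SU2,
        (∀ b ∈ feeds (((constrEnum (Bj ν.M₁ Z k) k).symm i').1 : ℕ) ((constrEnum (Bj ν.M₁ Z k) k).symm i').2.1, U' b = U₀ b) ∧
          SmallBelow (avOfRecord F 2 Kt) k U') →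
      (∀ (j : ℕ), 1 ≤ j → j ≤ k → ∀ y : Site (F.P Kt) j, embIter j y ∈ maxDomT ν.M₁ Z j → ∃ U' : GaugeField (F.P Kt) 0 SU2,
        (∀ c : PBond (F.P Kt) j, (c.src = y ∨ c.tgt = y) → ∀ b₀ : PBond (F.P Kt) 0,
          (iterBlockOf j b₀.src = c.src ∨ iterBlockOf j b₀.src = c.tgt) → (iterBlockOf j b₀.tgt = c.src ∨ iterBlockOf j b₀.tgt = c.tgt) → U' b₀ = U₀ b₀) ∧
        SmallBelow (avOfRecord F 2 Kt) k U') →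
      (∀ (j : ℕ), 1 ≤ j → j ≤ k → ∀ y : Site (F.P Kt) j, embIter j y ∈ maxDomT ν.M₁ Z j →
        PlaqSmallOn (boxPlaqs (fun κ => lift (F.P Kt) (embIter j y) κ - ((((F.P Kt).L ^ j : ℕ) : ℤ) + ((((F.P Kt).L ^ j - 1) / 2 : ℕ) : ℤ)))
          (fun κ => lift (F.P Kt) (embIter j y) κ + ((((F.P Kt).L ^ j : ℕ) : ℤ) + ((((F.P Kt).L ^ j - 1) / 2 : ℕ) : ℤ))) : Set (Plaq (F.P Kt) 0)) εH U₀) →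
      ∃ H : (Fin (constrCard (Bj ν.M₁ Z k) k) → lieSU (Fin 2)) → PBond (F.P Kt) 0 → lieSU (Fin 2),
        (∀ v, fderiv ℝ (msChart F 2 Kt k (Bj ν.M₁ Z k) Wd U₀) 0 (H v) = v) ∧ ∀ v, Real.sqrt (∑ b, ‖H v b‖ ^ 2) ≤ B * ‖v‖)
    (hεH : ν.εreg ≤ εH)
    (ext : GaugeField (F.P Kt) k SU2 → GaugeField (F.P Kt) k SU2) (hext : ∀ W, ext W = extend Λ (shellGauge W lo hi) W)
    {K : Set (GaugeField (F.P Kt) k SU2)} (hK : IsCompact K) {𝓐₀ : ℝ} (h𝓐₀ : 1 < 𝓐₀)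
    (hbase : ∀ Vk ∈ K, ∃ U₀ : GaugeField (F.P Kt) 0 SU2,
      IsMinimizer (Node00.avOfRecord F 2 Kt) (Node00.regMSCoPOfRecord F 2 ν Kt k (maxDomT ν.M₁ Z)) (Bj ν.M₁ Z k)
        (avgFamily (Node00.avOfRecord F 2 Kt) (qsstarGIter0 k (ext Vk))) U₀ ∧
      SmallBelow (Node00.avOfRecord F 2 Kt) k (qsstarGIter0 k (ext Vk)) ∧
      SmallBelow (Node00.avOfRecord F 2 Kt) k U₀ ∧
      -- DISPLAYED (β) ON EVERY FOREST AXIAL SLICE through the constrained towers of `𝐁_k(Z)` (no `t₀` row, no surjectivity row)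
      (∀ (S : Submodule ℂ (VecField (F.P Kt) 0 (EuclideanSpace ℂ (Fin 3)))) (path : Site (F.P Kt) 0 → List (LStep (F.P Kt) 0)),
        (∀ x, ∀ s ∈ path x, ∃ x' x'' : Site (F.P Kt) 0, path x'' = path x' ++ [s] ∧
          (s.fwd = true → s.bond.src = x' ∧ s.bond.tgt = x'') ∧ (s.fwd = false → s.bond.src = x'' ∧ s.bond.tgt = x')) →
        (∀ j, j ≤ k → ∀ c ∈ bondsOf (Bj ν.M₁ Z k j), path (embIter j c.src) = [] ∧ path (embIter j c.tgt) = []) →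
        (∀ X : VecField (F.P Kt) 0 (EuclideanSpace ℂ (Fin 3)), X ∈ S ↔ ∀ x, ∀ s ∈ path x, X s.bond = 0) →
        ∀ ℓ₀ : (Fin (constrCard (Bj ν.M₁ Z k) k) → EuclideanSpace ℂ (Fin 3)) →L[ℂ] ℂ,
          fderiv ℂ (fun X : S => ∑ p : Plaq (F.P Kt) 0, (1 - (expMulC (X : VecField (F.P Kt) 0 (EuclideanSpace ℂ (Fin 3))) (coeField U₀) ⟨p.src, p.μ⟩ *
            expMulC (X : VecField (F.P Kt) 0 (EuclideanSpace ℂ (Fin 3))) (coeField U₀) ⟨p.src.shift p.μ, p.ν⟩ *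
            Matrix.adjugate (expMulC (X : VecField (F.P Kt) 0 (EuclideanSpace ℂ (Fin 3))) (coeField U₀) ⟨p.src.shift p.ν, p.μ⟩) *
            Matrix.adjugate (expMulC (X : VecField (F.P Kt) 0 (EuclideanSpace ℂ (Fin 3))) (coeField U₀) ⟨p.src, p.ν⟩)).trace / 2)) 0 =
            ℓ₀.comp (fderiv ℂ (fun (X : S) (i : Fin (constrCard (Bj ν.M₁ Z k) k)) =>
              logCoordC (star ((avgFamily (Node00.avOfRecord F 2 Kt) (qsstarGIter0 k (ext Vk))
                ((constrEnum (Bj ν.M₁ Z k) k).symm i).1 ((constrEnum (Bj ν.M₁ Z k) k).symm i).2.1 : SU2) : Matrix (Fin 2) (Fin 2) ℂ) *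
                iterMh ((constrEnum (Bj ν.M₁ Z k) k).symm i).1 (expMulC (X : VecField (F.P Kt) 0 (EuclideanSpace ℂ (Fin 3))) (coeField U₀))
                  ((constrEnum (Bj ν.M₁ Z k) k).symm i).2.1)) 0) →
          ∀ (p : VecField (F.P Kt) 0 E3) (hp : cplxVec p ∈ S), p ≠ 0 →
            (∀ i : Fin (constrCard (Bj ν.M₁ Z k) k), dIterL ((constrEnum (Bj ν.M₁ Z k) k).symm i).1 (coeField U₀)
              (fun b => (∑ a : Fin 3, ((p b a : ℝ) : ℂ) • genE a) * ((U₀ b : SU2) : Matrix (Fin 2) (Fin 2) ℂ)) ((constrEnum (Bj ν.M₁ Z k) k).symm i).2.1 = 0) →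
            0 < deriv (deriv (fun t : ℝ => wilsonAction4 (expMul su2Chart (t • p) U₀) -
              (ℓ₀ ((fun (X : S) (i : Fin (constrCard (Bj ν.M₁ Z k) k)) =>
                logCoordC (star ((avgFamily (Node00.avOfRecord F 2 Kt) (qsstarGIter0 k (ext Vk))
                  ((constrEnum (Bj ν.M₁ Z k) k).symm i).1 ((constrEnum (Bj ν.M₁ Z k) k).symm i).2.1 : SU2) : Matrix (Fin 2) (Fin 2) ℂ) *
                  iterMh ((constrEnum (Bj ν.M₁ Z k) k).symm i).1 (expMulC (X : VecField (F.P Kt) 0 (EuclideanSpace ℂ (Fin 3))) (coeField U₀))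
                    ((constrEnum (Bj ν.M₁ Z k) k).symm i).2.1)) ((t : ℂ) • ⟨cplxVec p, hp⟩))).re)) 0) ∧
      -- DISPLAYED (T1@q₀) over the CLOSURE of NODE 00's class: the tower-central orbit of `U₀` is the unique minimal orbit
      (∀ U ∈ closure (Node00.regMSCoPOfRecord F 2 ν Kt k (maxDomT ν.M₁ Z)),
        AgreeOn (Bj ν.M₁ Z k) (avgFamily (Node00.avOfRecord F 2 Kt) U) (avgFamily (Node00.avOfRecord F 2 Kt) (qsstarGIter0 k (ext Vk))) →
        wilsonAction4 U ≤ wilsonAction4 U₀ →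
          ∃ u : GaugeTransf (F.P Kt) 0 SU2, (∀ j, j ≤ k → ∀ b ∈ bondsOf (Bj ν.M₁ Z k j),
            toMS u j b.src = toMS u j b.tgt ∧ ∀ g : SU2, toMS u j b.src * g = g * toMS u j b.src) ∧ gaugeAct u U = U₀)) :
    ∃ R : ℝ, 0 < R ∧ ∀ Vk ∈ K,
      ∃ Ũ : VecField (F.P Kt) k (EuclideanSpace ℂ (Fin 3)) × VecField (F.P Kt) k (EuclideanSpace ℂ (Fin 3)) → PBond (F.P Kt) 0 → Matrix (Fin 2) (Fin 2) ℂ,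
        (∀ b i j, DifferentiableOn ℂ (fun z => Ũ z b i j) (ball 0 R)) ∧
        (∀ z ∈ ball (0 : VecField (F.P Kt) k (EuclideanSpace ℂ (Fin 3)) × VecField (F.P Kt) k (EuclideanSpace ℂ (Fin 3))) R, ∀ b i j, ‖Ũ z b i j‖ ≤ 𝓐₀) ∧
        ∀ p B' : VecField (F.P Kt) k E3, ‖p‖ < R → ‖B'‖ < R → ∃ U' : GaugeField (F.P Kt) 0 SU2,
          (∀ b, Ũ (cplxVec p, cplxVec B') b = ((U' b : SU2) : Matrix (Fin 2) (Fin 2) ℂ)) ∧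
            IsMinimizer (Node00.avOfRecord F 2 Kt) (Node00.regMSCoPOfRecord F 2 ν Kt k (maxDomT ν.M₁ Z)) (Bj ν.M₁ Z k)
              (avgFamily (Node00.avOfRecord F 2 Kt) (qsstarGIter0 k (expMul su2Chart B' (ext (expMul su2Chart p Vk))))) U' := by
  have hL := three_le_L (F.P Kt)
  have hk : k ≤ (F.P Kt).m + (F.P Kt).K := Nat.le_of_succ_le hkK
  have hM4 : 4 * (F.P Kt).L ≤ ν.M₁ := le_trans (Nat.mul_le_mul_right _ (by omega)) hfloor
  have hM : 1 ≤ ν.M₁ := by omega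
  obtain ⟨hreg', hcl, hDreg'⟩ :=
    classLetters_closure_regMSCoPOfRecord_Bj (F := F) (N := 2) (K := Kt) ν hε hk hdiv hfloor Z k (Nat.le_succ k) hα3 hα2
  refine hMin_atRecord_of_node00Letters_thm1AtBase_central_surj_smallBelow ν Kt k (maxDomT ν.M₁ Z) Λ lo hi (Bj ν.M₁ Z k) (fun j hj => Bj_of_gt hj) hk ext hext hK h𝓐₀
    (closure (Node00.regMSCoPOfRecord F 2 ν Kt k (maxDomT ν.M₁ Z))) hreg' hcl hDreg' fun Vk hVk => ?_
  obtain ⟨U₀, hmin, hsbQ, hsbU, hβ, hT1⟩ := hbase Vk hVk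
  obtain ⟨path, S, hF1, hF2, -, hF3, -⟩ := exists_forest_slice_Bj (P := F.P Kt) (M₁ := ν.M₁) (Z := Z) hk hk1 hM hdiv
  exact ⟨U₀, S, path, _, _, hmin, hsbQ, hsbU, hF1, hF2, hF3, fun _ => rfl, fun _ _ => rfl,
    surjective_fderiv_msChart_Bj_of_isMinimizer_class ν Kt Z hkK hM4 hdiv hε.le hsbU' hερ hHB hεH hmin, hβ S path hF1 hF2 hF3, hT1⟩

end Record

end Summit.QuantumFields.YangMills.BalabanUVNodes.N12MinimiserFamilyAtRecordBjNoPlaqGuard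

end
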